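import Mathlib
import Literature.Computability.AlgebraicComplexity.RazElusiveGeneralProofs
import Summits.ValiantsHypothesis.ValiantsHypothesis.Theorems.SoloInformedQuadSpanReduction
import Summits.ValiantsHypothesis.ValiantsHypothesis.Theorems.SoloInformedPatternDesign
import HarnessLib

/-!
# The Reed–Muller evaluation design: sign-independence to order `2^{d+1} - 1` from `(L+1)^d`
positions, with an empty-sum definability witness (seat `solo-ValiantsHypothesis-informed`, s28)

A third explicit `(K, h)`-sign-independent family `S_i ⊆ Fin n`, `i < m`, for the univariate
reduction (`SoloInformedQuadSpanReduction`), exponentially more economical than the subpattern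
design of `SoloInformedPatternDesign` (which needs `C(L, K-1)·2^{K-1}` positions, capping
`K ≲ log n / log log n`) and, unlike the Reed–Solomon designs, still a PATTERN DESIGN with positive
literals only, so Raz's Def. 1.3 holds with `ℓ = 0` (`soloInformed_isPolyDefinableMap_pattern`):
* positions = maps `φ : Fin d → Option (Fin L)` (`(L+1)^d` of them), read as sets `J(φ)` of at most
  `d` bit positions; `S_i = {φ | bits(i) ⊇ J(φ)}` — the membership test is the monomial
  `∏_{p ∈ J(φ)} bit_p(i)` (`SoloPattern.reedMuller`);
* **parity lemma** (`solo_oddWitness_bits`): every nonempty set `Y` of fewer than `2^{d+1}` bit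
  vectors admits `J`, `|J| ≤ d`, with an ODD number of `y ∈ Y`, `y ⊇ J` (equivalently: the
  evaluation vectors of the monomials of degree `≤ d` are `(2^{d+1}-1)`-wise independent over `𝔽₂`,
  the dual distance of the Reed–Muller code `RM(d, L)`; proved here by a direct induction on the
  number of coordinates, no coding theory imported);
* **odd witnesses give sign-independence for every height** (`SoloDesign.ofOddWitness`, a 2-adic
  descent: all coefficients even ⇒ halve; else the odd-coefficient indices have an odd witness,
  where the relation fails mod 2) — the `𝔽₂` analogue of `SoloDesign.ofPrivatePoints`;
* `SoloPattern.reedMullerDesign`: with `m ≤ 2^L` and `(L+1)^d ≤ n` the Reed–Muller design is a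
  `(K, h)`-design for every `K < 2^{d+1}` and every `h`.
With `L ≈ 3ρ log₂ n`, `d = ⌊log_{L+1} n⌋` the order is `2^{Θ(log n / log log n)}`, above every
fixed power of `log s` along the reduction (`s = n^{2ρ+τ}`): this makes the growing-order (window)
form of the seat's Conjecture Q* a kernel implication (`SoloInformedQuadSpanWindow`).  Nothing
here is credited toward the summit.
References: R. Raz, Theory of Computing 6 (2010) 135–177, Def. 1.3 [Raz2010]; coding context
(dual of `RM(d, L)` is `RM(L-d-1, L)`, distance `2^{d+1}`): F. J. MacWilliams, N. J. A. Sloane,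
The Theory of Error-Correcting Codes (1977), Ch. 13, Thms 3–4.
-/

noncomputable section

open MvPolynomial Finset

namespace Summit.ValiantsHypothesis.ValiantsHypothesis.Theorems

open Literature.Computability.AlgebraicComplexity

/-! ### The parity lemma -/

/-- Counting a filter through an injective image. -/
private theorem solo_card_filter_image {α β : Type*} [DecidableEq β] (s : Finset α) (f : α → β)
    (hf : Set.InjOn f s) (q : β → Prop) [DecidablePred q] :
    ((s.image f).filter q).card = (s.filter fun a => q (f a)).card := by
  rw [Finset.filter_image, Finset.card_image_of_injOn]
  exact hf.mono (by intro a ha; exact (Finset.mem_filter.1 (Finset.mem_coe.1 ha)).1)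

/-- `Fin.tail` is injective on the vectors with a fixed first coordinate. -/
private theorem solo_tail_injOn {k : ℕ} (Y : Finset (Fin (k + 1) → Bool)) (b : Bool) :
    Set.InjOn Fin.tail ((Y.filter fun y => y 0 = b : Finset (Fin (k + 1) → Bool)) :
      Set (Fin (k + 1) → Bool)) := by
  intro y hy y' hy' h
  have hy0 : y 0 = b := (Finset.mem_filter.1 (Finset.mem_coe.1 hy)).2
  have hy'0 : y' 0 = b := (Finset.mem_filter.1 (Finset.mem_coe.1 hy')).2
  funext i
  refine Fin.cases ?_ (fun j => ?_) i
  · rw [hy0, hy'0]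
  · exact congrFun h j

/-- **Parity lemma** (dual distance of Reed–Muller codes, elementary form).  A nonempty set `Y`
of fewer than `2^{d+1}` vectors in `{0,1}^k` admits a set `J` of at most `d` coordinates such that
the number of `y ∈ Y` with `y_p = 1` for all `p ∈ J` is odd. -/
theorem solo_oddWitness_bits : ∀ (k d : ℕ) (Y : Finset (Fin k → Bool)), Y.Nonempty →
    Y.card < 2 ^ (d + 1) →
      ∃ J : Finset (Fin k), J.card ≤ d ∧ Odd (Y.filter fun y => ∀ p ∈ J, y p = true).card := by
  intro k
  induction k with
  | zero =>
    intro d Y hY _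
    refine ⟨∅, by simp, ?_⟩
    have h1 : Y.card ≤ 1 := by
      simpa [Fintype.card_fun] using Finset.card_le_univ Y
    have h2 : 1 ≤ Y.card := Finset.card_pos.2 hY
    rw [Finset.filter_true_of_mem (s := Y) fun y _ => by simp, show Y.card = 1 by omega]
    exact odd_one
  | succ k ih =>
    intro d Y hY hcard
    classical
    set Y0 := Y.filter fun y => y 0 = false with hY0
    set Y1 := Y.filter fun y => y 0 = true with hY1
    set Y0' := Y0.image Fin.tail with hY0'
    set Y1' := Y1.image Fin.tail with hY1'
    have h01 : Y0.card + Y1.card = Y.card := by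
      have h1 : Y1 = Y.filter fun y => ¬ (y 0 = false) := by
        ext y; simp [hY1]
      rw [h1]; exact Finset.card_filter_add_card_filter_not _
    have hc0 : Y0'.card = Y0.card := Finset.card_image_of_injOn (solo_tail_injOn Y false)
    have hc1 : Y1'.card = Y1.card := Finset.card_image_of_injOn (solo_tail_injOn Y true)
    have hcountA : ∀ J' : Finset (Fin k),
        (Y.filter fun y => ∀ p ∈ J'.map (Fin.succEmb k), y p = true).card =
          (Y0'.filter fun y => ∀ p ∈ J', y p = true).card +
            (Y1'.filter fun y => ∀ p ∈ J', y p = true).card := by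
      intro J'
      rw [solo_card_filter_image Y0 Fin.tail (solo_tail_injOn Y false),
        solo_card_filter_image Y1 Fin.tail (solo_tail_injOn Y true)]
      have hpred : (Y.filter fun y => ∀ p ∈ J'.map (Fin.succEmb k), y p = true) =
          Y.filter fun y => ∀ p ∈ J', Fin.tail y p = true := by
        refine Finset.filter_congr fun y _ => ?_
        simp [Fin.tail]
      rw [hpred, hY0, hY1, Finset.filter_filter, Finset.filter_filter]
      have h1 : (Y.filter fun y => y 0 = true ∧ ∀ p ∈ J', Fin.tail y p = true) =
          (Y.filter fun y => ∀ p ∈ J', Fin.tail y p = true).filter fun y => ¬ (y 0 = false) := by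
        ext y; simp [Finset.mem_filter]; tauto
      have h0 : (Y.filter fun y => y 0 = false ∧ ∀ p ∈ J', Fin.tail y p = true) =
          (Y.filter fun y => ∀ p ∈ J', Fin.tail y p = true).filter fun y => y 0 = false := by
        ext y; simp [Finset.mem_filter]; tauto
      rw [h0, h1]
      exact (Finset.card_filter_add_card_filter_not _).symm
    have hcountB : ∀ J' : Finset (Fin k),
        (Y.filter fun y => ∀ p ∈ insert 0 (J'.map (Fin.succEmb k)), y p = true).card =
          (Y1'.filter fun y => ∀ p ∈ J', y p = true).card := by
      intro J'
      rw [solo_card_filter_image Y1 Fin.tail (solo_tail_injOn Y true), hY1, Finset.filter_filter]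
      congr 1
      refine Finset.filter_congr fun y _ => ?_
      simp [Fin.tail]
    have hcardJ : ∀ J' : Finset (Fin k), (J'.map (Fin.succEmb k)).card = J'.card := fun J' =>
      Finset.card_map _
    by_cases he1 : Y1 = ∅
    · -- everything has first coordinate 0
      have hY0ne : Y0'.Nonempty := by
        rw [← Finset.card_pos, hc0]; have := Finset.card_pos.2 hY; rw [← h01, he1] at this
        simpa using this
      have hY0c : Y0'.card < 2 ^ (d + 1) := by rw [hc0]; omega
      obtain ⟨J', hJ', hodd⟩ := ih d Y0' hY0ne hY0c
      refine ⟨J'.map (Fin.succEmb k), by rw [hcardJ]; exact hJ', ?_⟩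
      rw [hcountA, show Y1' = ∅ by rw [hY1', he1]; rfl]
      simpa using hodd
    by_cases he0 : Y0 = ∅
    · have hY1ne : Y1'.Nonempty := by
        rw [← Finset.card_pos, hc1]; exact Finset.card_pos.2 (Finset.nonempty_iff_ne_empty.2 he1)
      have hY1c : Y1'.card < 2 ^ (d + 1) := by rw [hc1]; omega
      obtain ⟨J', hJ', hodd⟩ := ih d Y1' hY1ne hY1c
      refine ⟨J'.map (Fin.succEmb k), by rw [hcardJ]; exact hJ', ?_⟩
      rw [hcountA, show Y0' = ∅ by rw [hY0', he0]; rfl]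
      simpa using hodd
    -- both halves nonempty: `d ≥ 1`
    have hY0pos : 0 < Y0.card := Finset.card_pos.2 (Finset.nonempty_iff_ne_empty.2 he0)
    have hY1pos : 0 < Y1.card := Finset.card_pos.2 (Finset.nonempty_iff_ne_empty.2 he1)
    obtain ⟨d', rfl⟩ : ∃ d', d = d' + 1 := by
      refine ⟨d - 1, ?_⟩
      rcases Nat.eq_zero_or_pos d with h | h
      · subst h; simp at hcard; omega
      · omega
    have hpow : 2 ^ (d' + 1 + 1) = 2 ^ (d' + 1) + 2 ^ (d' + 1) := by ring
    by_cases hsmall1 : Y1.card < 2 ^ (d' + 1)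
    · have hY1ne : Y1'.Nonempty := by rw [← Finset.card_pos, hc1]; exact hY1pos
      obtain ⟨J', hJ', hodd⟩ := ih d' Y1' hY1ne (by rw [hc1]; exact hsmall1)
      refine ⟨insert 0 (J'.map (Fin.succEmb k)), ?_, ?_⟩
      · exact (Finset.card_insert_le _ _).trans (by rw [hcardJ]; omega)
      · rw [hcountB]; exact hodd
    · have hsmall0 : Y0.card < 2 ^ (d' + 1) := by omega
      have hY0ne : Y0'.Nonempty := by rw [← Finset.card_pos, hc0]; exact hY0pos
      obtain ⟨J', hJ', hodd⟩ := ih d' Y0' hY0ne (by rw [hc0]; exact hsmall0)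
      rcases Nat.even_or_odd (Y1'.filter fun y => ∀ p ∈ J', y p = true).card with hev | hod
      · refine ⟨J'.map (Fin.succEmb k), by rw [hcardJ]; omega, ?_⟩
        rw [hcountA]; exact hodd.add_even hev
      · refine ⟨insert 0 (J'.map (Fin.succEmb k)), ?_, ?_⟩
        · exact (Finset.card_insert_le _ _).trans (by rw [hcardJ]; omega)
        · rw [hcountB]; exact hod

/-! ### Odd witnesses give sign-independence (2-adic descent) -/

/-- In `ZMod 2` every element is `0` or `1`. -/
private theorem solo_zmod2_eq_zero_or_one : ∀ x : ZMod 2, x = 0 ∨ x = 1 := by decide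

/-- **Odd witnesses give a `(K, h)`-design, for every `h`.**  If every nonempty set `Y` of at most
`K` indices has a position `t` lying in an odd number of the sets `S i`, `i ∈ Y`, then no
nontrivial integer relation `∑ c_i 1_{S_i} = 0` with at most `K` terms exists (of any height):
if all `c_i` are even one halves them, otherwise the indices with odd `c_i` have an odd witness
`t`, where the relation fails modulo `2`. -/
def SoloDesign.ofOddWitness {K h m n : ℕ} (S : Fin m → Finset (Fin n))
    (hS : ∀ Y : Finset (Fin m), Y.Nonempty → Y.card ≤ K →
      ∃ t : Fin n, Odd (Y.filter fun i => t ∈ S i).card) :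
    SoloDesign K h m n where
  S := S
  indep := by
    classical
    intro c hc _ hsum
    -- descent on `N = ∑ |c i|`
    suffices hmain : ∀ (N : ℕ) (c : Fin m → ℤ), (∑ i, (c i).natAbs) = N →
        (univ.filter fun i => c i ≠ 0).card ≤ K →
          (∀ r : Fin n, (∑ i, if r ∈ S i then c i else 0) = 0) → ∀ i, c i = 0 from
      hmain _ c rfl hc hsum
    intro N
    induction N using Nat.strong_induction_on with
    | _ N ihN =>
      intro c hN hc hsum
      by_cases hzero : ∀ i, c i = 0
      · exact hzero
      push Not at hzero
      by_cases heven : ∀ i, (2 : ℤ) ∣ c i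
      · -- halve
        set c' : Fin m → ℤ := fun i => c i / 2 with hc'
        have hcc' : ∀ i, c i = 2 * c' i := fun i => (Int.mul_ediv_cancel' (heven i)).symm
        have hsupp : (univ.filter fun i => c' i ≠ 0) = univ.filter fun i => c i ≠ 0 := by
          ext i; simp only [Finset.mem_filter, Finset.mem_univ, true_and, hcc' i]; omega
        have hsum' : ∀ r : Fin n, (∑ i, if r ∈ S i then c' i else 0) = 0 := by
          intro r
          have h2 : (2 : ℤ) * (∑ i, if r ∈ S i then c' i else 0) =
              ∑ i, if r ∈ S i then c i else 0 := by
            rw [Finset.mul_sum]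
            refine Finset.sum_congr rfl fun i _ => ?_
            rw [hcc' i]; split_ifs <;> ring
          rw [hsum r] at h2
          simpa using h2
        have hN' : (∑ i, (c' i).natAbs) < N := by
          have h1 : N = 2 * ∑ i, (c' i).natAbs := by
            rw [← hN, Finset.mul_sum]
            refine Finset.sum_congr rfl fun i _ => ?_
            rw [hcc' i, Int.natAbs_mul]; rfl
          obtain ⟨i, hi⟩ := hzero
          have hi' : c' i ≠ 0 := by rw [hcc' i] at hi; omega
          have hpos : 0 < ∑ i, (c' i).natAbs :=
            Finset.sum_pos' (fun _ _ => Nat.zero_le _) ⟨i, Finset.mem_univ _,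
              Int.natAbs_pos.2 hi'⟩
          omega
        have := ihN _ hN' c' rfl (by rw [hsupp]; exact hc) hsum'
        intro i; rw [hcc' i, this i, mul_zero]
      · -- an odd coefficient: reduce mod 2 at an odd witness
        push Not at heven
        set Y : Finset (Fin m) := univ.filter fun i => ((c i : ℤ) : ZMod 2) ≠ 0 with hY
        have hYne : Y.Nonempty := by
          obtain ⟨i, hi⟩ := heven
          exact ⟨i, by simpa [hY, ZMod.intCast_zmod_eq_zero_iff_dvd] using hi⟩
        have hYK : Y.card ≤ K := by
          refine le_trans (Finset.card_le_card fun i hi => ?_) hc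
          simp only [hY, Finset.mem_filter, Finset.mem_univ, true_and] at hi ⊢
          rintro h0; exact hi (by simp [h0])
        obtain ⟨t, ht⟩ := hS Y hYne hYK
        have hrel : (∑ i, if t ∈ S i then ((c i : ℤ) : ZMod 2) else 0) = 0 := by
          have := congrArg (Int.cast : ℤ → ZMod 2) (hsum t)
          simpa [Int.cast_sum, apply_ite (Int.cast : ℤ → ZMod 2)] using this
        have hrel' : (∑ i, if t ∈ S i then ((c i : ℤ) : ZMod 2) else 0) =
            ((Y.filter fun i => t ∈ S i).card : ZMod 2) := by
          rw [Finset.card_eq_sum_ones, Nat.cast_sum, Finset.sum_filter, Finset.sum_filter]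
          refine Finset.sum_congr rfl fun i _ => ?_
          rcases solo_zmod2_eq_zero_or_one ((c i : ℤ) : ZMod 2) with h0 | h1
          · simp [h0]
          · simp [h1]
        rw [hrel'] at hrel
        obtain ⟨j, hj⟩ := ht
        rw [hj] at hrel
        have h2 : ((2 * j + 1 : ℕ) : ZMod 2) = 1 := by
          rw [Nat.cast_add, Nat.cast_mul, show ((2 : ℕ) : ZMod 2) = 0 from rfl]; simp
        rw [h2] at hrel
        exact absurd hrel one_ne_zero

/-! ### The Reed–Muller evaluation design -/

namespace SoloPattern

/-- Positions of the Reed–Muller design of degree `d` on `L` bits: maps `Fin d → Option (Fin L)`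
(a list of at most `d` bit positions, with blanks and repetitions allowed). -/
abbrev RMPos (L d : ℕ) : Type := Fin d → Option (Fin L)

/-- `|RMPos L d| = (L + 1)^d`. -/
theorem card_RMPos (L d : ℕ) : Fintype.card (RMPos L d) = (L + 1) ^ d := by
  rw [Fintype.card_fun, Fintype.card_option, Fintype.card_fin, Fintype.card_fin]

/-- The set of bit positions listed by a position. -/
def rmSet {L d : ℕ} (φ : RMPos L d) : Finset (Fin L) :=
  univ.biUnion fun q => (φ q).toFinset

/-- Membership in `rmSet φ`. -/
theorem mem_rmSet {L d : ℕ} (φ : RMPos L d) (p : Fin L) : p ∈ rmSet φ ↔ ∃ q, φ q = some p := by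
  simp [rmSet, Option.mem_toFinset, Option.mem_def]

/-- `rmSet φ` has at most `d` elements. -/
theorem card_rmSet_le {L d : ℕ} (φ : RMPos L d) : (rmSet φ).card ≤ d := by
  classical
  unfold rmSet
  calc (univ.biUnion fun q => (φ q).toFinset).card ≤ ∑ q : Fin d, (φ q).toFinset.card :=
        Finset.card_biUnion_le
    _ ≤ ∑ _q : Fin d, 1 := Finset.sum_le_sum fun q _ => by cases φ q <;> simp
    _ = d := by simp

/-- Every set `J` of at most `d` bit positions is listed by some position. -/
theorem exists_rmSet_eq {L d : ℕ} (J : Finset (Fin L)) (hJ : J.card ≤ d) :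
    ∃ φ : RMPos L d, rmSet φ = J := by
  classical
  let e : J ≃ Fin J.card := J.equivFin
  refine ⟨fun q => if hq : (q : ℕ) < J.card then some (e.symm ⟨q, hq⟩ : J) else none, ?_⟩
  ext p
  rw [mem_rmSet]
  constructor
  · rintro ⟨q, hq⟩
    by_cases hq' : (q : ℕ) < J.card
    · rw [dif_pos hq'] at hq
      have := Option.some_injective _ hq
      rw [← this]; exact (e.symm ⟨q, hq'⟩).2
    · rw [dif_neg hq'] at hq; exact absurd hq (by simp)
  · intro hp
    refine ⟨Fin.castLE hJ (e ⟨p, hp⟩), ?_⟩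
    have hlt : ((Fin.castLE hJ (e ⟨p, hp⟩) : Fin d) : ℕ) < J.card := by
      rw [Fin.val_castLE]; exact (e ⟨p, hp⟩).isLt
    rw [dif_pos hlt]
    congr 1
    have : (⟨((Fin.castLE hJ (e ⟨p, hp⟩) : Fin d) : ℕ), hlt⟩ : Fin J.card) = e ⟨p, hp⟩ := by
      ext; simp
    rw [this, Equiv.symm_apply_apply]

/-- Decoding a position of `Fin n` (positions beyond `(L+1)^d` are unused). -/
def rmDecode (n L d : ℕ) (t : Fin n) : Option (RMPos L d) :=
  if h : (t : ℕ) < Fintype.card (RMPos L d) then some ((Fintype.equivFin (RMPos L d)).symm ⟨t, h⟩)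
  else none

/-- Encoding a position into `Fin n` when there is room. -/
def rmEncode {n L d : ℕ} (h : Fintype.card (RMPos L d) ≤ n) (φ : RMPos L d) : Fin n :=
  Fin.castLE h (Fintype.equivFin (RMPos L d) φ)

/-- `rmDecode` inverts `rmEncode`. -/
theorem rmDecode_rmEncode {n L d : ℕ} (h : Fintype.card (RMPos L d) ≤ n) (φ : RMPos L d) :
    rmDecode n L d (rmEncode h φ) = some φ := by
  unfold rmDecode rmEncode
  have hlt : ((Fin.castLE h (Fintype.equivFin (RMPos L d) φ) : Fin n) : ℕ) <
      Fintype.card (RMPos L d) := by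
    rw [Fin.val_castLE]; exact (Fintype.equivFin (RMPos L d) φ).isLt
  rw [dif_pos hlt]
  congr 1
  apply (Fintype.equivFin (RMPos L d)).injective
  rw [Equiv.apply_symm_apply]
  ext; simp only [Fin.val_castLE]

/-- **The Reed–Muller evaluation design** of degree `d` on `n` positions and `L` index bits: the
position listing the bit positions `J` (`|J| ≤ d`) tests `bit_p(i) = 1` for all `p ∈ J`, so
`S i = {J | bits(i) ⊇ J}` and the membership test is the monomial `∏_{p ∈ J} bit_p(i)`; unused
positions test nothing. -/
def reedMuller (n L d : ℕ) : SoloPattern n L where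
  P t := match rmDecode n L d t with
    | some φ => rmSet φ
    | none => ∅
  v _ _ := true

/-- The bit positions tested at the position encoding `φ` are `rmSet φ`. -/
theorem reedMuller_P_rmEncode {n L d : ℕ} (h : Fintype.card (RMPos L d) ≤ n) (φ : RMPos L d) :
    (reedMuller n L d).P (rmEncode h φ) = rmSet φ := by
  simp only [reedMuller, rmDecode_rmEncode h φ]

/-- Membership at an encoded position: `bits(i) ⊇ rmSet φ`. -/
theorem mem_reedMuller_S_rmEncode {n L d : ℕ} (h : Fintype.card (RMPos L d) ≤ n) (φ : RMPos L d)
    (i : ℕ) : rmEncode h φ ∈ (reedMuller n L d).S i ↔ ∀ p ∈ rmSet φ, i.testBit p = true := by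
  rw [mem_S, reedMuller_P_rmEncode]
  rfl

/-- The bit vector of an index on `L` bits. -/
def bitVec (L i : ℕ) : Fin L → Bool := fun p => i.testBit p

/-- Indices below `2^L` are determined by their bit vectors. -/
theorem bitVec_injOn {L m : ℕ} (hm : m ≤ 2 ^ L) (Y : Finset (Fin m)) :
    Set.InjOn (fun i : Fin m => bitVec L i) (Y : Set (Fin m)) := by
  intro i _ j _ hij
  exact Fin.ext (eq_of_testBit_eq_of_lt (lt_of_lt_of_le i.2 hm) (lt_of_lt_of_le j.2 hm)
    fun p => congrFun hij p)

/-- **Odd witnesses of the Reed–Muller design.**  If the indices are `< m ≤ 2^L` and the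
`(L+1)^d` positions fit into `Fin n`, every nonempty set of fewer than `2^{d+1}` indices has a
position lying in an odd number of its sets. -/
theorem reedMuller_oddWitness {n L d m : ℕ} (hn : (L + 1) ^ d ≤ n) (hm : m ≤ 2 ^ L) :
    ∀ Y : Finset (Fin m), Y.Nonempty → Y.card < 2 ^ (d + 1) →
      ∃ t : Fin n, Odd (Y.filter fun i : Fin m => t ∈ (reedMuller n L d).S (i : ℕ)).card := by
  classical
  intro Y hY hcard
  have hn' : Fintype.card (RMPos L d) ≤ n := by rw [card_RMPos]; exact hn
  set Yv : Finset (Fin L → Bool) := Y.image fun i : Fin m => bitVec L i with hYv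
  have hYv_card : Yv.card = Y.card := Finset.card_image_of_injOn (bitVec_injOn hm Y)
  obtain ⟨J, hJ, hodd⟩ := solo_oddWitness_bits L d Yv (by rw [hYv]; exact hY.image _)
    (by rw [hYv_card]; exact hcard)
  obtain ⟨φ, hφ⟩ := exists_rmSet_eq J hJ
  refine ⟨rmEncode hn' φ, ?_⟩
  have hc : (Y.filter fun i : Fin m => rmEncode hn' φ ∈ (reedMuller n L d).S (i : ℕ)).card =
      (Yv.filter fun y => ∀ p ∈ J, y p = true).card := by
    rw [hYv, solo_card_filter_image Y _ (bitVec_injOn hm Y)]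
    congr 1
    refine Finset.filter_congr fun i _ => ?_
    rw [mem_reedMuller_S_rmEncode, hφ]
    rfl
  rw [hc]; exact hodd

/-- **The Reed–Muller design is a `(K, h)`-design** for every `K ≤ 2^{d+1} - 1` and every `h`,
provided `m ≤ 2^L` and `(L+1)^d ≤ n`. -/
def reedMullerDesign {n L d m K : ℕ} (h : ℕ) (hn : (L + 1) ^ d ≤ n) (hm : m ≤ 2 ^ L)
    (hK : K < 2 ^ (d + 1)) : SoloDesign K h m n :=
  SoloDesign.ofOddWitness (fun i : Fin m => (reedMuller n L d).S (i : ℕ)) fun Y hY hYK =>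
    reedMuller_oddWitness hn hm Y hY (lt_of_le_of_lt hYK hK)

end SoloPattern

end Summit.ValiantsHypothesis.ValiantsHypothesis.Theorems

end
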